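import Literature.Computability.QuantumComplexity.CliffordSimulator
import Literature.Computability.QuantumComplexity.StabilizerSimulationProofs
import HarnessLib

/-!
# Bravyi–Gosset's rank bound `χ(|T⟩^{⊗t}) ≤ 2^{⌈t/2⌉}` (the exponent `β = 1/2`)

Topic `Literature/Computability/QuantumComplexity`. A proved ingredient of the named fact
`BravyiGosset2016_estimateAcceptProb` (`StabilizerSimulation.lean`): the stabilizer decomposition
of the magic-state register that the Bravyi–Gosset estimator enumerates, and whose number of terms
`2^{⌈t/2⌉}` is the exponential factor of `CliffordTInstance.timeBound` ("`β ≤ 1/2`").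

S. Bravyi, D. Gosset, *Improved classical simulation of quantum circuits dominated by Clifford
gates*, PRL 116 (2016) 250501 = arXiv:1601.07601, §4 "Classical simulation algorithms" (end of
the analysis of the first algorithm), eq. (17) of the arXiv version:
`|A^{⊗2}⟩ = ½ (|00⟩ + i|11⟩) + (e^{iπ/4}/2) (|01⟩ + |10⟩)`, "one can see that `A^{⊗2}` is a
linear combination of two stabilizer states, that is, `χ₂ = 2`. By dividing `t` qubits into
`t/2` pairs and applying the decomposition to each pair one gets `χ_t ≤ 2^{t/2}`." Here `|A⟩`
is the tree's `magicT = T H |0⟩`.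

## Contents (all proved)

* `tensorPow_add`: `ψ^{⊗(a+b)} = ψ^{⊗a} ⊗ ψ^{⊗b}` for the tree's `tensorPow`/`tensorVec`
  (re-association of the wire blocks `Fin.castAdd`/`Fin.natAdd`), whence
  `stabilizerRank_tensorPow_add_le`: `χ(ψ^{⊗(a+b)}) ≤ χ(ψ^{⊗a}) χ(ψ^{⊗b})` by the discharged
  sub-multiplicativity `BravyiSmithSmolin2016_stabilizerRank_tensorVec_le_holds`;
* `CliffordSim.BG.identity`: eq. (17) as an exact identity in `ℤ[ω]^4`, **decided by the kernel**
  with the executable simulator of `CliffordSimulator.lean` (scaled arithmetic `H ↦ √2 H`):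
  `2 · (ω^{|x|})_x = 2 · [H₀, S₀, CNOT₀₁]|00⟩ + ω · [H₀, CNOT₀₁, H₁, S₁, S₁, H₁]|00⟩`, the two Clifford
  words preparing `|00⟩ + i|11⟩` and `2(|01⟩ + |10⟩)` (`H S S H = 2X`);
* `CliffordSim.BG.magicT_pow_two_decomposition`, `stabilizerRank_magicT_pow_two_le`: `χ(|T⟩^{⊗2}) ≤ 2`;
* `stabilizerRank_magicT_pow_le_two_pow`: **`χ(|T⟩^{⊗t}) ≤ 2^{⌈t/2⌉}`** for every `t`
  (pairs, plus `χ ≤ 2¹` for a single leftover qubit), written `2 ^ ((t + 1) / 2)` as in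
  `CliffordTInstance.timeBound`;
* `BravyiGosset2016_stabilizerRank_output_le.le_two_pow`: threaded through the gadgetization fact,
  `χ(U|y⟩) ≤ 2^{⌈t/2⌉}` for an oracle-free Clifford+`T` circuit with `t` `T`-gates;
* `BravyiSmithSmolin2016_stabilizerRank_magicT_pow_six_mul_holds` — **discharge** of the named fact
  `BravyiSmithSmolin2016_stabilizerRank_magicT_pow_six_mul` of `StabilizerSimulation.lean`,
  `χ(|T⟩^{⊗6m}) ≤ 7^m` (Bravyi–Smith–Smolin 2016, §I: "`χ₆ ≤ 7`, which implies
  `χ_n ≤ (χ₆)^{n/6} ≤ 7^{n/6}`"): induction on `m` by `stabilizerRank_tensorPow_add_le` and the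
  discharged `χ(|T⟩^{⊗6}) ≤ 7` (`BravyiSmithSmolin2016_stabilizerRank_magicT_pow_six_holds`,
  `CliffordSimulator.lean`).

## References

* S. Bravyi, D. Gosset, *Improved classical simulation of quantum circuits dominated by Clifford
  gates*, Phys. Rev. Lett. 116 (2016) 250501, arXiv:1601.07601: §4, eq. (17) (`χ₂ = 2`,
  `χ_t ≤ 2^{t/2}`); p. 2, eq. (2) (`β ≤ 1/2`).
* S. Bravyi, G. Smith, J. A. Smolin, *Trading classical and quantum computational resources*,
  Phys. Rev. X 6 (2016) 021043, arXiv:1506.01396: §I (`χ₂ = 2`, `χ_{n+m} ≤ χ_n χ_m`,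
  `χ_n ≤ (χ₆)^{n/6} ≤ 7^{n/6}`), §IV eqs. (9), (11).
* M. A. Nielsen, I. L. Chuang, *Quantum Computation and Quantum Information*, CUP 2010, §2.1.7
  (tensor products), §4.2 (`H Z H = X`, Ex. 4.18).
-/

noncomputable section

namespace Literature.Computability.QuantumComplexity

open _root_.Computability Complexity Cryptography Matrix

/-! ### Tensor powers split along `a + b` -/

/-- **`ψ^{⊗(a+b)} = ψ^{⊗a} ⊗ ψ^{⊗b}`** for the tree's `tensorPow` (which adds one factor at a
time on the right): re-association of the wire blocks. [Nielsen–Chuang 2010, §2.1.7] [folklore] -/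
theorem tensorPow_add (ψ : QReg 1 → ℂ) (a : ℕ) : ∀ b : ℕ,
    tensorPow ψ (a + b) = tensorVec (tensorPow ψ a) (tensorPow ψ b)
  | 0 => by
    funext z
    have e0 : (fun i : Fin a => z (Fin.castAdd 0 i)) = z := funext fun i => congrArg z (Fin.ext rfl)
    calc tensorPow ψ (a + 0) z = tensorPow ψ a z := rfl
      _ = tensorPow ψ a (fun i => z (Fin.castAdd 0 i)) * 1 := by rw [e0, mul_one]
      _ = tensorVec (tensorPow ψ a) (tensorPow ψ 0) z := rfl
  | b + 1 => by
    funext z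
    have ih := tensorPow_add ψ a b
    have e1 : (fun i : Fin a => z (Fin.castAdd 1 (Fin.castAdd b i))) =
        fun i => z (Fin.castAdd (b + 1) i) :=
      funext fun i => congrArg z (Fin.ext rfl)
    have e2 : (fun j : Fin b => z (Fin.castAdd 1 (Fin.natAdd a j))) =
        fun j => z (Fin.natAdd a (Fin.castAdd 1 j)) :=
      funext fun j => congrArg z (Fin.ext rfl)
    have e3 : (fun k : Fin 1 => z (Fin.natAdd (a + b) k)) =
        fun k => z (Fin.natAdd a (Fin.natAdd b k)) :=
      funext fun k => congrArg z (Fin.ext (Nat.add_assoc a b k))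
    calc tensorPow ψ (a + (b + 1)) z
        = tensorVec (tensorPow ψ (a + b)) ψ z := rfl
      _ = tensorPow ψ a (fun i => z (Fin.castAdd 1 (Fin.castAdd b i))) *
            tensorPow ψ b (fun j => z (Fin.castAdd 1 (Fin.natAdd a j))) *
            ψ (fun k => z (Fin.natAdd (a + b) k)) := by rw [ih]; rfl
      _ = tensorPow ψ a (fun i => z (Fin.castAdd (b + 1) i)) *
            (tensorPow ψ b (fun j => z (Fin.natAdd a (Fin.castAdd 1 j))) *
              ψ (fun k => z (Fin.natAdd a (Fin.natAdd b k)))) := by rw [e1, e2, e3, mul_assoc]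
      _ = tensorVec (tensorPow ψ a) (tensorPow ψ (b + 1)) z := rfl

/-- **`χ(ψ^{⊗(a+b)}) ≤ χ(ψ^{⊗a}) · χ(ψ^{⊗b})`** (sub-multiplicativity along a split of the
register; Bravyi–Smith–Smolin 2016, §I: "`χ_{n+m} ≤ χ_n χ_m`").
[cite: BravyiSmithSmolin2016, §I] -/
theorem stabilizerRank_tensorPow_add_le (ψ : QReg 1 → ℂ) (a b : ℕ) :
    stabilizerRank (tensorPow ψ (a + b)) ≤
      stabilizerRank (tensorPow ψ a) * stabilizerRank (tensorPow ψ b) := by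
  rw [tensorPow_add]
  exact BravyiSmithSmolin2016_stabilizerRank_tensorVec_le_holds _ _

/-! ### `χ(|T⟩^{⊗2}) ≤ 2`: the pair identity, decided by the kernel -/

namespace CliffordSim

open LightCone

namespace BG

/-- The two Clifford words of the pair decomposition (wires `0, 1`; scaled arithmetic):
`[H₀, S₀, CNOT₀₁]|00⟩ = |00⟩ + i|11⟩` and `[H₀, CNOT₀₁, H₁, S₁, S₁, H₁]|00⟩ = 2(|01⟩ + |10⟩)`
(`H S S H = 2·X` with the scaled Hadamard). [cite: BravyiGosset2016, §4 eq. (17)] -/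
def ops : Fin 2 → List (Op 2) :=
  ![[Op.H 0, Op.S 0, Op.CX 0 1 (by decide)],
    [Op.H 0, Op.CX 0 1 (by decide), Op.H 1, Op.S 1, Op.S 1, Op.H 1]]

/-- The two coefficients `2` and `ω = e^{iπ/4}` (coordinates of `1, ω, ω², ω³`): twice the
printed `½` and `e^{iπ/4}/2`, the second word carrying the extra factor `2`.
[cite: BravyiGosset2016, §4 eq. (17)] -/
def coef : Fin 2 → Amp :=
  ![⟨2, 0, 0, 0⟩, ⟨0, 1, 0, 0⟩]

/-- The global factor `2`. [folklore] -/
def scaleK : Amp := ⟨2, 0, 0, 0⟩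

/-- **Eq. (17) of Bravyi–Gosset, decided by the kernel**: `2 · (ω^{|x|})_{x ∈ 𝔽₂²} =
2 · [H₀,S₀,CNOT₀₁]|00⟩ + ω · [H₀,CNOT₀₁,H₁,S₁,S₁,H₁]|00⟩` in `ℤ[ω]^4`, i.e.
`√2² |A^{⊗2}⟩ = (|00⟩ + i|11⟩) + ω (|01⟩ + |10⟩)`. [cite: BravyiGosset2016, §4 eq. (17)] -/
theorem identity : Vec.smul scaleK (Vec.magic 2) = lsum 2 coef (fun i => run (ops i) (Vec.vac 2)) := by
  decide +kernel

/-- Both words are `T`-free. [folklore] -/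
theorem ops_clifford (i : Fin 2) : ∀ o ∈ ops i, o.isClifford = true := by
  fin_cases i <;> decide

/-- **`|T⟩^{⊗2}` is a linear combination of two stabilizer states** (Bravyi–Gosset 2016, §4,
eq. (17): "`χ₂ = 2`"). [cite: BravyiGosset2016, §4 eq. (17)] -/
theorem magicT_pow_two_decomposition :
    ∃ (c : Fin 2 → ℂ) (φ : Fin 2 → QReg 2 → ℂ),
      (∀ i, φ i ∈ stabilizerStates 2) ∧ tensorPow magicT 2 = ∑ i, c i • φ i := by
  choose φ hφ hS using fun i => exists_stabilizer (ops i) (ops_clifford i)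
  have key := congrArg Vec.toState identity
  rw [Vec.toState_smul, toState_magic, toState_lsum] at key
  simp only [hS, smul_smul] at key
  set K : ℂ := Amp.eval omega scaleK * ((Real.sqrt 2 : ℝ) : ℂ) ^ 2 with hK
  have hK0 : K ≠ 0 := by
    have h2 : ((Real.sqrt 2 : ℝ) : ℂ) ≠ 0 := by
      rw [Ne, Complex.ofReal_eq_zero]
      positivity
    have hs : Amp.eval omega scaleK = 2 := by
      simp [Amp.eval, scaleK]
    rw [hK, hs]
    exact mul_ne_zero two_ne_zero (pow_ne_zero _ h2)
  refine ⟨fun i => K⁻¹ * (Amp.eval omega (coef i) * ((Real.sqrt 2 : ℝ) : ℂ) ^ countH (ops i)), φ, hφ, ?_⟩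
  calc tensorPow magicT 2 = K⁻¹ • (K • tensorPow magicT 2) := by
        rw [smul_smul, inv_mul_cancel₀ hK0, one_smul]
    _ = K⁻¹ • ∑ i, (Amp.eval omega (coef i) * ((Real.sqrt 2 : ℝ) : ℂ) ^ countH (ops i)) • φ i := by
        rw [hK, key]
    _ = ∑ i, (K⁻¹ * (Amp.eval omega (coef i) * ((Real.sqrt 2 : ℝ) : ℂ) ^ countH (ops i))) • φ i := by
        rw [Finset.smul_sum]
        simp only [smul_smul]

end BG

end CliffordSim

/-- **`χ(|T⟩^{⊗2}) ≤ 2`** (Bravyi–Gosset 2016, §4 eq. (17): "`A^{⊗2}` is a linear combination of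
two stabilizer states, that is, `χ₂ = 2`"; the two states witness the infimum defining
`stabilizerRank`). [cite: BravyiGosset2016, §4 eq. (17)] -/
theorem stabilizerRank_magicT_pow_two_le : stabilizerRank (tensorPow magicT 2) ≤ 2 := by
  obtain ⟨c, φ, hφ, h⟩ := CliffordSim.BG.magicT_pow_two_decomposition
  exact Nat.sInf_le ⟨c, φ, hφ, h⟩

/-! ### `χ(|T⟩^{⊗t}) ≤ 2^{⌈t/2⌉}` -/

/-- **Bravyi–Gosset's rank bound `χ(|T⟩^{⊗t}) ≤ 2^{⌈t/2⌉}`** (2016, §4, after eq. (17): "By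
dividing `t` qubits into `t/2` pairs and applying the decomposition to each pair one gets
`χ_t ≤ 2^{t/2}`"; for odd `t` the leftover qubit has `χ ≤ 2`, giving the ceiling). This is the
exponent `β = 1/2` of eq. (2) and of `CliffordTInstance.timeBound`, `2 ^ ((t + 1) / 2)`.
[cite: BravyiGosset2016, §4 eq. (17) and p. 2 eq. (2)] -/
theorem stabilizerRank_magicT_pow_le_two_pow : ∀ t : ℕ,
    stabilizerRank (tensorPow magicT t) ≤ 2 ^ ((t + 1) / 2)
  | 0 => by simpa using stabilizerRank_tensorPow_zero_le magicT
  | 1 => (stabilizerRank_le_two_pow _).trans (by norm_num)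
  | t + 2 => by
    calc stabilizerRank (tensorPow magicT (t + 2))
        ≤ stabilizerRank (tensorPow magicT t) * stabilizerRank (tensorPow magicT 2) :=
          stabilizerRank_tensorPow_add_le magicT t 2
      _ ≤ 2 ^ ((t + 1) / 2) * 2 :=
          Nat.mul_le_mul (stabilizerRank_magicT_pow_le_two_pow t) stabilizerRank_magicT_pow_two_le
      _ = 2 ^ ((t + 2 + 1) / 2) := by
          rw [← pow_succ]
          congr 1
          omega

/-- The same bound at the `T`-count of a simulation instance: `χ(|T⟩^{⊗t}) ≤ 2^{⌈t/2⌉}` with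
`t = i.tCount`, the exponential factor of `i.timeBound c k`. [cite: BravyiGosset2016, p. 2 eq. (2)] -/
theorem CliffordTInstance.stabilizerRank_magicT_pow_tCount_le (i : CliffordTInstance) :
    stabilizerRank (tensorPow magicT i.tCount) ≤ 2 ^ ((i.tCount + 1) / 2) :=
  stabilizerRank_magicT_pow_le_two_pow _

/-- **With the gadgetization bound, `χ(U|y⟩) ≤ 2^{⌈t/2⌉}`** for an oracle-free Clifford+`T`
circuit `U` with `t` `T`-gates applied to a basis state (Bravyi–Gosset 2016, §4: the final state
is a linear combination of `χ_t ≤ 2^{t/2}` stabilizer states). [cite: BravyiGosset2016, §4 eq. (17)] -/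
theorem BravyiGosset2016_stabilizerRank_output_le.le_two_pow
    (h : BravyiGosset2016_stabilizerRank_output_le) {N : ℕ} (U : QCircuit cliffordT N)
    (hU : U.IsOracleFree) (A : Language Bool) (y : QReg N) :
    stabilizerRank (U.toMatrix A *ᵥ basisState y) ≤ 2 ^ ((U.tCount + 1) / 2) :=
  (h U hU A y).trans (stabilizerRank_magicT_pow_le_two_pow _)

/-! ### Discharge of `BravyiSmithSmolin2016_stabilizerRank_magicT_pow_six_mul` -/

/-- **Discharge of `BravyiSmithSmolin2016_stabilizerRank_magicT_pow_six_mul`: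
`χ(|T⟩^{⊗6m}) ≤ 7^m`** (Bravyi–Smith–Smolin 2016, §I: "`χ₆ ≤ 7`, which implies
`χ_n ≤ (χ₆)^{n/6} ≤ 7^{n/6}`", the `m`-fold tensor power §IV eq. (9) of the decomposition
eq. (11)). Induction on `m`: `|T⟩^{⊗6(m+1)} = |T⟩^{⊗6m} ⊗ |T⟩^{⊗6}` (`tensorPow_add`, here a
definitional unfolding of `6(m+1) = 6m + 6`), sub-multiplicativity
(`stabilizerRank_tensorPow_add_le`) and the kernel-checked seven-term decomposition
`χ(|T⟩^{⊗6}) ≤ 7` (`BravyiSmithSmolin2016_stabilizerRank_magicT_pow_six_holds`).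
[cite: BravyiSmithSmolin2016, §I and §IV eqs. (9), (11)] -/
theorem BravyiSmithSmolin2016_stabilizerRank_magicT_pow_six_mul_holds :
    BravyiSmithSmolin2016_stabilizerRank_magicT_pow_six_mul := by
  show ∀ m : ℕ, stabilizerRank (tensorPow magicT (6 * m)) ≤ 7 ^ m
  intro m
  induction m with
  | zero => simpa using stabilizerRank_tensorPow_zero_le magicT
  | succ m ih =>
    calc stabilizerRank (tensorPow magicT (6 * (m + 1)))
        = stabilizerRank (tensorPow magicT (6 * m + 6)) := rfl
      _ ≤ stabilizerRank (tensorPow magicT (6 * m)) * stabilizerRank (tensorPow magicT 6) :=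
          stabilizerRank_tensorPow_add_le magicT (6 * m) 6
      _ ≤ 7 ^ m * 7 := Nat.mul_le_mul ih BravyiSmithSmolin2016_stabilizerRank_magicT_pow_six_holds
      _ = 7 ^ (m + 1) := (pow_succ 7 m).symm

end Literature.Computability.QuantumComplexity
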